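import Summits.QuantumFields.QCD.Theorems.WindowExtinction.Negative.SpectralFlowLocal
import Summits.QuantumFields.QCD.Theorems.ExtinctionBuildsQCD.Negative.InertiaPencil

/-!
# Rank slack: a perturbation supported on `T` lowers the negative count by at most `|T|`
(sub-goal `negRootCount_le_add_card_of_support` of crux stmt-QuantumFields-8967)

Deterministic linear algebra for the modular cell–wall template and for 8964-r3's `stub_inertiaMonotone` (lead c2; serves stub
`stub_spreadOfCells` of line `hermitian-flow-coarea` r3 for crux `TipPricing`): if the Hermitian `Δ` vanishes on `Tᶜ × Tᶜ`
(i.e. `v†Δv = 0` for every `v` vanishing on `T`), then `n₋(X) ≤ n₋(X + Δ) + |T|`.  Proof: the negative eigenspace of `X` meets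
`{v | v|_T = 0}` in dimension `≥ n₋(X) − |T|`; there the forms of `X + Δ` and `X` agree and are negative; apply the tree's inertia
bound `card_le_card_eigenvalues_of_form_pos` (pattern of `card_filter_lt_neg_le`).  Supports stmt-QuantumFields-8967 (helper).
-/

namespace Summit.QuantumFields.QCD.Cruxes.TipPricing.ModularTemplate

open Matrix
open Summit.QuantumFields.QCD.Theorems.ExtinctionBuildsQCD.Negative
open Summit.QuantumFields.QCD.Theorems.WindowExtinction.Negative
open scoped BigOperators

variable {n : Type*} [Fintype n] [DecidableEq n]

/-- **Rank slack for the negative count.**  `X`, `Δ` Hermitian, `Δ i j = 0` whenever `i ∉ T` and `j ∉ T`; then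
`negRootCount X ≤ negRootCount (X + Δ) + T.card`. [folklore] -/
theorem negRootCount_le_add_card_of_support {X Δ : Matrix n n ℂ} (hX : X.IsHermitian) (hΔ : Δ.IsHermitian)
    (T : Finset n) (hsupp : ∀ i j, i ∉ T → j ∉ T → Δ i j = 0) :
    negRootCount X ≤ negRootCount (X + Δ) + T.card := by
  have hB : (X + Δ).IsHermitian := hX.add hΔ
  set U : Matrix n n ℂ := (hX.eigenvectorUnitary : Matrix n n ℂ) with hU
  let I := {i // hX.eigenvalues i < 0}
  let J := {i // ¬ hX.eigenvalues i < 0}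
  -- Φ v = ((U†v) on the non-negative eigen-coordinates, v on T)
  let Φ₁ : (n → ℂ) →ₗ[ℂ] (J → ℂ) :=
    (LinearMap.pi fun j : J => LinearMap.proj (R := ℂ) (φ := fun _ : n => ℂ) j.1) ∘ₗ Uᴴ.mulVecLin
  let Φ₂ : (n → ℂ) →ₗ[ℂ] (↥T → ℂ) :=
    LinearMap.pi fun t : ↥T => LinearMap.proj (R := ℂ) (φ := fun _ : n => ℂ) t.1
  let Φ : (n → ℂ) →ₗ[ℂ] (J → ℂ) × (↥T → ℂ) := LinearMap.prod Φ₁ Φ₂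
  let W : Submodule ℂ (n → ℂ) := LinearMap.ker Φ
  have hWmem₁ : ∀ v ∈ W, ∀ j, ¬ hX.eigenvalues j < 0 → (Uᴴ *ᵥ v) j = 0 := by
    intro v hv j hj
    have h := LinearMap.mem_ker.1 hv
    have h1 : Φ₁ v = 0 := (Prod.mk_eq_zero.1 h).1
    have := congrFun h1 ⟨j, hj⟩
    simpa [Φ₁] using this
  have hWmem₂ : ∀ v ∈ W, ∀ t ∈ T, v t = 0 := by
    intro v hv t ht
    have h := LinearMap.mem_ker.1 hv
    have h2 : Φ₂ v = 0 := (Prod.mk_eq_zero.1 h).2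
    have := congrFun h2 ⟨t, ht⟩
    simpa [Φ₂] using this
  -- dimension count
  have hWdim : Fintype.card I ≤ Module.finrank ℂ W + T.card := by
    have h1 := Φ.finrank_range_add_finrank_ker
    have h2 : Module.finrank ℂ (LinearMap.range Φ) ≤ Fintype.card J + T.card := by
      calc Module.finrank ℂ (LinearMap.range Φ) ≤ Module.finrank ℂ ((J → ℂ) × (↥T → ℂ)) := Submodule.finrank_le _
        _ = Fintype.card J + T.card := by
            rw [Module.finrank_prod, Module.finrank_fintype_fun_eq_card, Module.finrank_fintype_fun_eq_card,
              Fintype.card_coe]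
    have h3 : Module.finrank ℂ (n → ℂ) = Fintype.card n := Module.finrank_fintype_fun_eq_card ℂ
    have h4 : Fintype.card I + Fintype.card J = Fintype.card n := by
      rw [Fintype.card_subtype_compl, Nat.add_sub_cancel' (Fintype.card_subtype_le _)]
    change Fintype.card I ≤ Module.finrank ℂ (LinearMap.ker Φ) + T.card
    omega
  -- the form of `X + Δ` is negative on `W`
  have hW : ∀ v ∈ W, v ≠ 0 → (star v ⬝ᵥ (X + Δ) *ᵥ v).re < 0 := by
    intro v hv hv0
    -- `v†Δv = 0`
    have hΔv : (star v ⬝ᵥ Δ *ᵥ v) = 0 := by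
      rw [dotProduct]
      refine Finset.sum_eq_zero fun i _ => ?_
      by_cases hi : i ∈ T
      · rw [Pi.star_apply, hWmem₂ v hv i hi, star_zero, zero_mul]
      · rw [mulVec, dotProduct]
        have : ∑ j, Δ i j * v j = 0 := by
          refine Finset.sum_eq_zero fun j _ => ?_
          by_cases hj : j ∈ T
          · rw [hWmem₂ v hv j hj, mul_zero]
          · rw [hsupp i j hi hj, zero_mul]
        rw [this, mul_zero]
    -- `v†Xv < 0`
    set w := Uᴴ *ᵥ v with hw
    have hS := sum_norm_sq_eigenvectorUnitary_conjTranspose_mulVec hX v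
    rw [← hU, ← hw] at hS
    have hSpos : 0 < ∑ j, ‖w j‖ ^ 2 := by rw [hS]; exact sum_norm_sq_pos hv0
    have hqX : (star v ⬝ᵥ X *ᵥ v).re < 0 := by
      rw [re_form_eq_sum_eigenvalues hX v, ← hU, ← hw]
      have hle : ∀ j ∈ Finset.univ, hX.eigenvalues j * ‖w j‖ ^ 2 ≤ 0 := by
        intro j _
        by_cases hj : hX.eigenvalues j < 0
        · exact mul_nonpos_of_nonpos_of_nonneg hj.le (by positivity)
        · have h0 : w j = 0 := by rw [hw]; exact hWmem₁ v hv j hj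
          rw [h0]; simp
      obtain ⟨j₀, hj₀⟩ : ∃ j, w j ≠ 0 := Function.ne_iff.mp (fun h => by rw [h] at hSpos; simp at hSpos)
      have hj₀I : hX.eigenvalues j₀ < 0 := by
        by_contra hc
        exact hj₀ (by rw [hw]; exact hWmem₁ v hv j₀ hc)
      have hlt : hX.eigenvalues j₀ * ‖w j₀‖ ^ 2 < 0 :=
        mul_neg_of_neg_of_pos hj₀I (by positivity)
      calc ∑ j, hX.eigenvalues j * ‖w j‖ ^ 2 < ∑ _j : n, (0 : ℝ) := Finset.sum_lt_sum hle ⟨j₀, Finset.mem_univ _, hlt⟩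
        _ = 0 := by simp
    rw [add_mulVec, dotProduct_add, Complex.add_re, hΔv, Complex.zero_re, add_zero]
    exact hqX
  -- inertia bound applied to a basis of `W`
  set d := Module.finrank ℂ W with hd
  let b := Module.finBasis ℂ W
  let E : (Fin d → ℂ) →ₗ[ℂ] (n → ℂ) := W.subtype ∘ₗ (b.equivFun.symm : (Fin d → ℂ) →ₗ[ℂ] W)
  have hEpos : ∀ c : Fin d → ℂ, c ≠ 0 → 0 < (-1 : ℝ) * (star (E c) ⬝ᵥ ((X + Δ) *ᵥ E c)).re := by
    intro c hc
    have hmem : E c ∈ W := (b.equivFun.symm c).2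
    have hne : E c ≠ 0 := by
      intro h0
      apply hc
      change ((b.equivFun.symm c : W) : n → ℂ) = 0 at h0
      have h1 : b.equivFun.symm c = 0 := Subtype.ext h0
      have h2 := congrArg b.equivFun h1
      rwa [LinearEquiv.apply_symm_apply, map_zero] at h2
    have := hW (E c) hmem hne
    nlinarith
  have h := card_le_card_eigenvalues_of_form_pos hB (-1) E hEpos
  rw [Fintype.card_fin] at h
  have hfin : (Finset.univ.filter fun i => 0 < (-1 : ℝ) * hB.eigenvalues i).card =
      (Finset.univ.filter fun i => hB.eigenvalues i < 0).card := by
    congr 1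
    exact Finset.filter_congr fun i _ => by constructor <;> intro h' <;> nlinarith
  rw [hfin, ← negRootCount_eq_card hB] at h
  have hI : negRootCount X = Fintype.card I := by
    rw [negRootCount_eq_card hX, Fintype.card_subtype]
  rw [hI]
  omega

end Summit.QuantumFields.QCD.Cruxes.TipPricing.ModularTemplate
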